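import Summits.QuantumFields.YangMills.Theorems.BalabanUVNodesN12NearFlatChartLetterNCore
import Summits.QuantumFields.YangMills.Theorems.BalabanUVNodesN12NearFlatChartLetterEta

/-!
# DAG node N12 [B15] — THE CHART LETTER (χ)_N: THE TWO SOCKETS (`∃ q` form = dag-n12-w5's text; `q_η` form), one-screen corollaries of the core
# `…N12NearFlatChartLetterNCore.chartLetter_of_letters_supNorm_N`

[Balaban1989LargeFieldII] = «[LF-II]», p. 357, (1.12)–(1.13) p. 359, (17)–(19) pp. 360–361; [Balaban1985Variational] = «[15]», Sect. C (44)–(48) p. 285, (81)–(83) p. 290;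
[Balaban1988Convergent] = «[III]», (2.2) p. 255, (2.10)–(2.13) pp. 256–257.

Cell `pub-ymgap`, HUMAN RULINGS D-0062 ∕ D-0149, width seat `pub-ymgap-dag-n12-w4` generation 4 (INBOX CLAIM-4 ∕ INTENT-6 of 2026-08-28; lane owner dag-n12-c g19 LOCATED-CIN ruling and SOCKET OF
RECORD v2 l.38237; dag-n12-w5 g5 socket text l.38320).  Key K1⁹ `stmt-QuantumFields-27364`, `--kind proof --supports stmt-QuantumFields-27364 --as helper`; count-neutral.  NEW leaf; CONSUMED
BY NAME, nothing modified: the core `chartLetter_of_letters_supNorm_N` (this seat), `…N12NearFlatChartLetterEta.norm_le_qEta` (this seat, p632050), dag-n10-w1's `N12EtaSizeDefs.qEta_def` and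
`N12NearFlatDelta2LetterEta.qEta_le_sqrt_sum_mul_norm`.

CONTENTS (namespace `Summit.QuantumFields.YangMills.BalabanUVNodes.N12NearFlatChartLetterN`; theorems only — no `def`, no `instance`, no `sorry`).
* ★★★ `chartLetter_of_letters_N` — p630404's `chartLetter_of_letters` (the letter `hχ` of p625120 with a free `q`, `∃ Ψ₂ λ p q L_f R_f`) with `Cin` localised: EXACTLY dag-n12-w5's socket
  text for `…Prop1OfGaugeLetterAndChartConstantsLoc` §2 (`Cin ↦ ∀ b ∈ inputs 𝐁_k(Z), b ∈ N → …`; binders `(N) (hN : inputsPos 𝐁_k(Z) ⊆ N)` after `hΩw`; `h2 : 2 ≤ d` dropped as unused).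
* ★★ `chartLetter_of_letters_eta_N` — p632050's `chartLetter_of_letters_eta` (p629636 §4's `(χ)_η`, `q := q_η` of `N12EtaSizeDefs`) with the same two changes (`h2` kept: `‖v‖ ≤ q_η(v)` needs
  `2 ≤ d`).
JUNCTION NOTE (dag-n12-w5's (iii) §2 twin): `chartLetter_of_letters_N ν Kt h0 (hk0 i) (hk i) (Z i) (Λ i) (T i) (lo i) (hi i) hM2 (hdiv i) hbox' (hΩw i) (N i) (hN i)` — p631882 §1's call
minus `h2`, plus `(N i) (hN i)`; the lane's canonical `N i ⊇` plaquette-closure of `N₁(Ω₁(Z i)) ∪ inputsPos 𝐁_{k_i}(Z i)` meets `hN i` by `Set.subset_union_right`-type one-liners.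

HONEST FRAMING ∕ LOCATED.  Corollaries by name; every constant per-height ∕ per-instance EXISTENCE, NOT print's volume-uniform ones; `ρc` in `(ℓ²(HS), sup)` resp. `(ℓ²(HS), q_η)` currency
carries dag-n10-w1's LOCATED-RHO floor exactly as p630404 ∕ p632050 do.  Nothing of Bałaban's (1.7) ∕ (1.12) ∕ Prop. 1 is asserted; count-neutral helper; N12 NOT discharged; K1⁹ NOT
closed; counts unmoved; one finite 𝕋⁴ programme at fixed ε — R4 closes the conditional finite-𝕋⁴ rung `BalabanLadder.UV` only; NOT continuum ∕ OS ∕ mass gap ∕ Clay.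
-/

noncomputable section

open scoped BigOperators Matrix.Norms.L2Operator Topology NNReal
open Filter Finset Metric

namespace Summit.QuantumFields.YangMills.BalabanUVNodes.N12NearFlatChartLetterN

open Literature.MathematicalPhysics.QuantumFieldTheory.Balaban1983to89
open T4Continuum (T4Family)
open T4AdjointCovarianceUnitary (lieSU)
open T4CubeChartGnomonic (SU2)
open B15DeterminingSets GaugeField
open B14.Eq213DetSet (Bj maxDomT)
open B14.Eq213MaximalDomains (side)
open B14.Eq216Concrete (inputs)
open B14.Eq12InteriorLocality (inputsPos)
open B15Prop1SliceCoordinates (GaugeSlice ιA)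
open B15Prop1ChartCalculusSU2 (E3)
open B15Prop1ChartSU2 (su2Chart)
open B16Sect1Backgrounds (expMul)
open T4AxialGaugeSmallField (castSite)
open B6TreeGaugePoincare (curl)
open B16Eq18Proof (box)
open Literature.MathematicalPhysics.QuantumFieldTheory.BalabanImbrieJaffe1984to88.BIJ85Eq453GaugeField (qsstarGIter0)
open Node00
open Summit.QuantumFields.YangMills.BalabanUVNodes.N12EtaSizeDefs (qEta levelWeight qEta_def)
open Summit.QuantumFields.YangMills.BalabanUVNodes.N12NearFlatDelta2LetterEta (qEta_le_sqrt_sum_mul_norm)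
open Summit.QuantumFields.YangMills.BalabanUVNodes.N12NearFlatChartLetter (norm_le_qEta)

variable {F : T4Family}

section Main

set_option maxHeartbeats 400000 in
/-- ★★★ **THE CHART LETTER (χ)_N — dag-n12-w5's socket text**: p630404's `chartLetter_of_letters` (free `q`: `∃ Ψ₂ λ p q L_f R_f, …`) with the inputs' near-flatness premise localised to
`N ⊇ inputsPos 𝐁_k(Z)` (`Cin ↦ ∀ b ∈ inputs 𝐁_k(Z), b ∈ N → ‖↑(U₀ b) − 1‖ ≤ δin`; binders `(N) (hN)` after `hΩw`; `h2` dropped).  The core `chartLetter_of_letters_supNorm_N` read with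
`q := ‖·‖`. [cite: Balaban1989LargeFieldII, p.357, (1.7)–(1.9) p.358, (1.12)–(1.13) p.359; Balaban1985Variational, Sect. C (44)–(48) p.285, (81)–(83) p.290, (172) p.305; Balaban1988Convergent, (2.2) p.255, (2.10)–(2.13) pp.256–257] -/
theorem chartLetter_of_letters_N (ν : Node00.Stage7Numerics) (Kt : ℕ) (h0 : 0 < (F.P Kt).d)
    {k : ℕ} (hk0 : 0 < k) (hk : k ≤ (F.P Kt).m + (F.P Kt).K)
    (Z Λ : Set (Site (F.P Kt) 0)) (T : Finset (PBond (F.P Kt) k)) (lo hi : Fin (F.P Kt).d → ℤ)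
    -- instance geometry letters (displayed)
    (hM2 : 2 ≤ ν.M₁) (hdiv : side (F.P Kt).L ν.M₁ k ∣ (F.P Kt).sitesPerDir 0)
    (hbox : ∀ κ, (((hi κ - lo κ + 1).toNat + 3 : ℕ) : ℤ) ≤ (F.P Kt).sitesPerDir k)
    (hΩw : ∀ (ν' : Fin (F.P Kt).d), ∀ z ∈ box (fun κ => (hi κ - lo κ + 1).toNat + 3) (fun κ => lo κ - 2),
      (castSite z : Site (F.P Kt) k) ∈ pts k (maxDomT ν.M₁ Z k) ∧ (castSite z : Site (F.P Kt) k).shift ⟨0, h0⟩ ∈ pts k (maxDomT ν.M₁ Z k) ∧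
        (castSite z : Site (F.P Kt) k).shift ν' ∈ pts k (maxDomT ν.M₁ Z k))
    -- the localised near-flatness region of the gauge letter (σ)_N: any bond set containing the towers of the constrained bonds of levels ≥ 1
    (N : Set (PBond (F.P Kt) 0)) (hN : inputsPos (Bj ν.M₁ Z k) ⊆ N) :
    ∃ ρs Cμ Cρ C₂ Cτ : ℝ, 0 < ρs ∧ 0 ≤ Cμ ∧ 0 ≤ Cρ ∧ 0 ≤ C₂ ∧ 0 ≤ Cτ ∧
      ∀ (ext : GaugeField (F.P Kt) k SU2 → GaugeField (F.P Kt) k SU2) (Vk : GaugeField (F.P Kt) k SU2) {R 𝓐₀ : ℝ}, 0 < R → 0 ≤ 𝓐₀ →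
      ∀ {δc δin : ℝ}, 0 ≤ δc → 0 ≤ δin → 0 < max δc δin → max δc δin ≤ ρs →
      ∀ (U₀ : GaugeField (F.P Kt) 0 SU2) (Xf : GaugeSlice (pts k Λ) T E3 → PBond (F.P Kt) 0 → lieSU (Fin 2)),
      IsMinimizer (Node00.avOfRecord F 2 Kt) (Node00.regMSCoPOfRecord F 2 ν Kt k (maxDomT ν.M₁ Z)) (Bj ν.M₁ Z k)
        (avgFamily (Node00.avOfRecord F 2 Kt) (qsstarGIter0 k (ext Vk))) U₀ →
      (∀ p : Plaq (F.P Kt) 0, ((⟨p.src, p.μ⟩ : PBond (F.P Kt) 0) ∈ {b : PBond (F.P Kt) 0 | b.src ∈ maxDomT ν.M₁ Z 1} ∨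
          (⟨p.src.shift p.μ, p.ν⟩ : PBond (F.P Kt) 0) ∈ {b : PBond (F.P Kt) 0 | b.src ∈ maxDomT ν.M₁ Z 1} ∨
          (⟨p.src.shift p.ν, p.μ⟩ : PBond (F.P Kt) 0) ∈ {b : PBond (F.P Kt) 0 | b.src ∈ maxDomT ν.M₁ Z 1} ∨
          (⟨p.src, p.ν⟩ : PBond (F.P Kt) 0) ∈ {b : PBond (F.P Kt) 0 | b.src ∈ maxDomT ν.M₁ Z 1}) →
        ‖((U₀ ⟨p.src, p.μ⟩ : SU2) : Matrix (Fin 2) (Fin 2) ℂ) - 1‖ ≤ δc ∧ ‖((U₀ ⟨p.src.shift p.μ, p.ν⟩ : SU2) : Matrix (Fin 2) (Fin 2) ℂ) - 1‖ ≤ δc ∧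
          ‖((U₀ ⟨p.src.shift p.ν, p.μ⟩ : SU2) : Matrix (Fin 2) (Fin 2) ℂ) - 1‖ ≤ δc ∧ ‖((U₀ ⟨p.src, p.ν⟩ : SU2) : Matrix (Fin 2) (Fin 2) ℂ) - 1‖ ≤ δc) →
      (∀ b ∈ inputs (Bj ν.M₁ Z k), b ∈ N → ‖((U₀ b : SU2) : Matrix (Fin 2) (Fin 2) ℂ) - 1‖ ≤ δin) →
      Xf 0 = 0 → ContDiffAt ℝ 2 Xf 0 →
      (∀ᶠ Y in 𝓝 (0 : GaugeSlice (pts k Λ) T E3),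
        IsMinimizer (Node00.avOfRecord F 2 Kt) (Node00.regMSCoPOfRecord F 2 ν Kt k (maxDomT ν.M₁ Z)) (Bj ν.M₁ Z k)
          (avgFamily (Node00.avOfRecord F 2 Kt) (qsstarGIter0 k (expMul su2Chart (ιA (pts k Λ) T Y) (ext Vk)))) (expChart U₀ (Xf Y))) →
      (∀ (X : GaugeSlice (pts k Λ) T E3) (b : PBond (F.P Kt) 0),
        ‖((fderiv ℝ Xf 0 X b : lieSU (Fin 2)) : Matrix (Fin 2) (Fin 2) ℂ)‖ ≤ 8 * 𝓐₀ / R * ‖X‖ ∧ ‖fderiv ℝ Xf 0 X b‖ ≤ 12 * 𝓐₀ / R * ‖X‖) →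
      (∀ (X : GaugeSlice (pts k Λ) T E3) (b : PBond (F.P Kt) 0), b.src ∉ maxDomT ν.M₁ Z 1 → fderiv ℝ Xf 0 X b = 0) →
      ∃ (Ψ₂ : (PBond (F.P Kt) 0 → lieSU (Fin 2)) →L[ℝ] (PBond (F.P Kt) 0 → lieSU (Fin 2)) →L[ℝ] (Fin (constrCard (Bj ν.M₁ Z k) k) → lieSU (Fin 2)))
        (lam : (Fin (constrCard (Bj ν.M₁ Z k) k) → lieSU (Fin 2)) →L[ℝ] ℝ)
        (p : Seminorm ℝ (PBond (F.P Kt) 0 → lieSU (Fin 2))) (q : (Fin (constrCard (Bj ν.M₁ Z k) k) → lieSU (Fin 2)) → ℝ)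
        (Lf : (PBond (F.P Kt) 0 → lieSU (Fin 2)) →L[ℝ] (Fin (constrCard (Bj ν.M₁ Z k) k) → lieSU (Fin 2)))
        (Rf : (Fin (constrCard (Bj ν.M₁ Z k) k) → lieSU (Fin 2)) → PBond (F.P Kt) 0 → lieSU (Fin 2)),
        HasFDerivAt (fun Y => fderiv ℝ (msChart F 2 Kt k (Bj ν.M₁ Z k) (avgFamily (Node00.avOfRecord F 2 Kt) (qsstarGIter0 k (ext Vk))) U₀) Y) Ψ₂ 0 ∧
        (∀ᶠ Y in 𝓝 (0 : PBond (F.P Kt) 0 → lieSU (Fin 2)),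
          DifferentiableAt ℝ (msChart F 2 Kt k (Bj ν.M₁ Z k) (avgFamily (Node00.avOfRecord F 2 Kt) (qsstarGIter0 k (ext Vk))) U₀) Y) ∧
        fderiv ℝ (fun Y : PBond (F.P Kt) 0 → lieSU (Fin 2) => wilsonAction4 (expChart U₀ Y)) 0 =
          lam.comp (fderiv ℝ (msChart F 2 Kt k (Bj ν.M₁ Z k) (avgFamily (Node00.avOfRecord F 2 Kt) (qsstarGIter0 k (ext Vk))) U₀) 0) ∧
        (∀ Y : PBond (F.P Kt) 0 → lieSU (Fin 2), ∑ b, ‖(Y b : Matrix (Fin 2) (Fin 2) ℂ)‖ ^ 2 ≤ p Y ^ 2) ∧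
        (∀ v, Lf (Rf v) = v) ∧ (∀ v, p (Rf v) ≤ Cρ * q v) ∧
        ∀ X : GaugeSlice (pts k Λ) T E3,
          q (fderiv ℝ (msChart F 2 Kt k (Bj ν.M₁ Z k) (avgFamily (Node00.avOfRecord F 2 Kt) (qsstarGIter0 k (ext Vk))) U₀) 0 (fderiv ℝ Xf 0 X)
              - Lf (fderiv ℝ Xf 0 X)) ≤ (C₂ * max δc δin) * p (fderiv ℝ Xf 0 X) ∧
          lam (Ψ₂ (fderiv ℝ Xf 0 X) (fderiv ℝ Xf 0 X)) ≤ (Cμ * max δc δin) * p (fderiv ℝ Xf 0 X) ^ 2 ∧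
          p (fderiv ℝ Xf 0 X) ≤ (12 * 𝓐₀ / R * Real.sqrt (Nat.card {b : PBond (F.P Kt) 0 // b.src ∈ maxDomT ν.M₁ Z 1})) * ‖X‖ ∧
          ∃ m : ℝ, (∀ w', Lf w' = fderiv ℝ (msChart F 2 Kt k (Bj ν.M₁ Z k) (avgFamily (Node00.avOfRecord F 2 Kt) (qsstarGIter0 k (ext Vk))) U₀) 0
                (fderiv ℝ Xf 0 X) →
              m ≤ fderiv ℝ (fun Y => fderiv ℝ (fun Y : PBond (F.P Kt) 0 → lieSU (Fin 2) => wilsonAction4 (expChart (1 : GaugeField (F.P Kt) 0 SU2) Y)) Y) 0 w' w') ∧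
            (((F.P Kt).L : ℝ) ^ (F.P Kt).d) ^ k / ((((F.P Kt).L : ℝ)) ^ 2 * ((F.P Kt).L : ℝ) ^ 2) ^ k *
                (∑ z ∈ box (fun κ => (hi κ - lo κ + 1).toNat + 3) (fun κ => lo κ - 2), ∑ μ : Fin (F.P Kt).d, ∑ a : Fin 3,
                  curl (fun b => ιA (pts k Λ) T X (⟨castSite b.1, b.2⟩ : PBond (F.P Kt) k) a) z ⟨0, h0⟩ μ ^ 2)
              - ((((F.P Kt).L : ℝ) ^ (F.P Kt).d) ^ k / ((((F.P Kt).L : ℝ)) ^ 2 * ((F.P Kt).L : ℝ) ^ 2) ^ k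
                  * (16 * (((F.P Kt).d : ℝ) + 1) * (Cτ * max δc δin))) * ‖X‖ ^ 2 ≤ m := by
  obtain ⟨ρs, Cμ, Cρ, C₂, Cτ, hρs, hCμ, hCρ, hC₂, hCτ, H⟩ := chartLetter_of_letters_supNorm_N ν Kt h0 hk0 hk Z Λ T lo hi hM2 hdiv hbox hΩw N hN
  refine ⟨ρs, Cμ, Cρ, C₂, Cτ, hρs, hCμ, hCρ, hC₂, hCτ, ?_⟩
  intro ext Vk R 𝓐₀ hR h𝓐₀ δc δin hδc0 hδin0 hδpos hδρ U₀ Xf hmin0 hC1 hCin hX₀ hXc hmin hKb hsupp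
  obtain ⟨Ψ₂, lam, p, Lf, Rf, hΨ₂, hΨd, hlam, hp, hRf, hρ, htail⟩ :=
    H ext Vk hR h𝓐₀ hδc0 hδin0 hδpos hδρ U₀ Xf hmin0 hC1 hCin hX₀ hXc hmin hKb hsupp
  exact ⟨Ψ₂, lam, p, fun v => ‖v‖, Lf, Rf, hΨ₂, hΨd, hlam, hp, hRf, hρ, htail⟩


set_option maxHeartbeats 400000 in
/-- ★★ **THE CHART LETTER `(χ)_η,N`** — p632050's `chartLetter_of_letters_eta` (`q := q_η`, the right-inverse row through `‖v‖ ≤ q_η(v)` at `2 ≤ d`, the (δ₂) row through dag-n10-w1's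
`qEta_le_sqrt_sum_mul_norm`, `C₂ ↦ C₂·√(Σ_i levelWeight j_i)`) with `Cin` localised to `N ⊇ inputsPos 𝐁_k(Z)` — the core read in print's η-units.
[cite: Balaban1989LargeFieldII, p.357, (1.12)–(1.13) p.359, (17)–(19) pp.360–361; Balaban1985Variational, Sect. C (44)–(48) p.285, (81)–(83) p.290; Balaban1988Convergent, (2.2) p.255, (2.10)–(2.13) pp.256–257] -/
theorem chartLetter_of_letters_eta_N (ν : Node00.Stage7Numerics) (Kt : ℕ) (h0 : 0 < (F.P Kt).d) (h2 : 2 ≤ (F.P Kt).d)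
    {k : ℕ} (hk0 : 0 < k) (hk : k ≤ (F.P Kt).m + (F.P Kt).K)
    (Z Λ : Set (Site (F.P Kt) 0)) (T : Finset (PBond (F.P Kt) k)) (lo hi : Fin (F.P Kt).d → ℤ)
    -- instance geometry letters (displayed)
    (hM2 : 2 ≤ ν.M₁) (hdiv : side (F.P Kt).L ν.M₁ k ∣ (F.P Kt).sitesPerDir 0)
    (hbox : ∀ κ, (((hi κ - lo κ + 1).toNat + 3 : ℕ) : ℤ) ≤ (F.P Kt).sitesPerDir k)
    (hΩw : ∀ (ν' : Fin (F.P Kt).d), ∀ z ∈ box (fun κ => (hi κ - lo κ + 1).toNat + 3) (fun κ => lo κ - 2),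
      (castSite z : Site (F.P Kt) k) ∈ pts k (maxDomT ν.M₁ Z k) ∧ (castSite z : Site (F.P Kt) k).shift ⟨0, h0⟩ ∈ pts k (maxDomT ν.M₁ Z k) ∧
        (castSite z : Site (F.P Kt) k).shift ν' ∈ pts k (maxDomT ν.M₁ Z k))
    (N : Set (PBond (F.P Kt) 0)) (hN : inputsPos (Bj ν.M₁ Z k) ⊆ N) :
    ∃ ρs Cμ Cρ C₂ Cτ : ℝ, 0 < ρs ∧ 0 ≤ Cμ ∧ 0 ≤ Cρ ∧ 0 ≤ C₂ ∧ 0 ≤ Cτ ∧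
      ∀ (ext : GaugeField (F.P Kt) k SU2 → GaugeField (F.P Kt) k SU2) (Vk : GaugeField (F.P Kt) k SU2) {R 𝓐₀ : ℝ}, 0 < R → 0 ≤ 𝓐₀ →
      ∀ {δc δin : ℝ}, 0 ≤ δc → 0 ≤ δin → 0 < max δc δin → max δc δin ≤ ρs →
      ∀ (U₀ : GaugeField (F.P Kt) 0 SU2) (Xf : GaugeSlice (pts k Λ) T E3 → PBond (F.P Kt) 0 → lieSU (Fin 2)),
      IsMinimizer (Node00.avOfRecord F 2 Kt) (Node00.regMSCoPOfRecord F 2 ν Kt k (maxDomT ν.M₁ Z)) (Bj ν.M₁ Z k)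
        (avgFamily (Node00.avOfRecord F 2 Kt) (qsstarGIter0 k (ext Vk))) U₀ →
      (∀ p : Plaq (F.P Kt) 0, ((⟨p.src, p.μ⟩ : PBond (F.P Kt) 0) ∈ {b : PBond (F.P Kt) 0 | b.src ∈ maxDomT ν.M₁ Z 1} ∨
          (⟨p.src.shift p.μ, p.ν⟩ : PBond (F.P Kt) 0) ∈ {b : PBond (F.P Kt) 0 | b.src ∈ maxDomT ν.M₁ Z 1} ∨
          (⟨p.src.shift p.ν, p.μ⟩ : PBond (F.P Kt) 0) ∈ {b : PBond (F.P Kt) 0 | b.src ∈ maxDomT ν.M₁ Z 1} ∨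
          (⟨p.src, p.ν⟩ : PBond (F.P Kt) 0) ∈ {b : PBond (F.P Kt) 0 | b.src ∈ maxDomT ν.M₁ Z 1}) →
        ‖((U₀ ⟨p.src, p.μ⟩ : SU2) : Matrix (Fin 2) (Fin 2) ℂ) - 1‖ ≤ δc ∧ ‖((U₀ ⟨p.src.shift p.μ, p.ν⟩ : SU2) : Matrix (Fin 2) (Fin 2) ℂ) - 1‖ ≤ δc ∧
          ‖((U₀ ⟨p.src.shift p.ν, p.μ⟩ : SU2) : Matrix (Fin 2) (Fin 2) ℂ) - 1‖ ≤ δc ∧ ‖((U₀ ⟨p.src, p.ν⟩ : SU2) : Matrix (Fin 2) (Fin 2) ℂ) - 1‖ ≤ δc) →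
      (∀ b ∈ inputs (Bj ν.M₁ Z k), b ∈ N → ‖((U₀ b : SU2) : Matrix (Fin 2) (Fin 2) ℂ) - 1‖ ≤ δin) →
      Xf 0 = 0 → ContDiffAt ℝ 2 Xf 0 →
      (∀ᶠ Y in 𝓝 (0 : GaugeSlice (pts k Λ) T E3),
        IsMinimizer (Node00.avOfRecord F 2 Kt) (Node00.regMSCoPOfRecord F 2 ν Kt k (maxDomT ν.M₁ Z)) (Bj ν.M₁ Z k)
          (avgFamily (Node00.avOfRecord F 2 Kt) (qsstarGIter0 k (expMul su2Chart (ιA (pts k Λ) T Y) (ext Vk)))) (expChart U₀ (Xf Y))) →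
      (∀ (X : GaugeSlice (pts k Λ) T E3) (b : PBond (F.P Kt) 0),
        ‖((fderiv ℝ Xf 0 X b : lieSU (Fin 2)) : Matrix (Fin 2) (Fin 2) ℂ)‖ ≤ 8 * 𝓐₀ / R * ‖X‖ ∧ ‖fderiv ℝ Xf 0 X b‖ ≤ 12 * 𝓐₀ / R * ‖X‖) →
      (∀ (X : GaugeSlice (pts k Λ) T E3) (b : PBond (F.P Kt) 0), b.src ∉ maxDomT ν.M₁ Z 1 → fderiv ℝ Xf 0 X b = 0) →
      ∃ (Ψ₂ : (PBond (F.P Kt) 0 → lieSU (Fin 2)) →L[ℝ] (PBond (F.P Kt) 0 → lieSU (Fin 2)) →L[ℝ] (Fin (constrCard (Bj ν.M₁ Z k) k) → lieSU (Fin 2)))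
        (lam : (Fin (constrCard (Bj ν.M₁ Z k) k) → lieSU (Fin 2)) →L[ℝ] ℝ)
        (p : Seminorm ℝ (PBond (F.P Kt) 0 → lieSU (Fin 2)))
        (Lf : (PBond (F.P Kt) 0 → lieSU (Fin 2)) →L[ℝ] (Fin (constrCard (Bj ν.M₁ Z k) k) → lieSU (Fin 2)))
        (Rf : (Fin (constrCard (Bj ν.M₁ Z k) k) → lieSU (Fin 2)) → PBond (F.P Kt) 0 → lieSU (Fin 2)),
        HasFDerivAt (fun Y => fderiv ℝ (msChart F 2 Kt k (Bj ν.M₁ Z k) (avgFamily (Node00.avOfRecord F 2 Kt) (qsstarGIter0 k (ext Vk))) U₀) Y) Ψ₂ 0 ∧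
        (∀ᶠ Y in 𝓝 (0 : PBond (F.P Kt) 0 → lieSU (Fin 2)),
          DifferentiableAt ℝ (msChart F 2 Kt k (Bj ν.M₁ Z k) (avgFamily (Node00.avOfRecord F 2 Kt) (qsstarGIter0 k (ext Vk))) U₀) Y) ∧
        fderiv ℝ (fun Y : PBond (F.P Kt) 0 → lieSU (Fin 2) => wilsonAction4 (expChart U₀ Y)) 0 =
          lam.comp (fderiv ℝ (msChart F 2 Kt k (Bj ν.M₁ Z k) (avgFamily (Node00.avOfRecord F 2 Kt) (qsstarGIter0 k (ext Vk))) U₀) 0) ∧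
        (∀ Y : PBond (F.P Kt) 0 → lieSU (Fin 2), ∑ b, ‖(Y b : Matrix (Fin 2) (Fin 2) ℂ)‖ ^ 2 ≤ p Y ^ 2) ∧
        (∀ v, Lf (Rf v) = v) ∧ (∀ v, p (Rf v) ≤ Cρ * Real.sqrt (∑ i, ((((F.P Kt).L : ℝ) ^ (F.P Kt).d) / (((F.P Kt).L : ℝ) ^ 2)) ^ (((Node00.constrEnum (Bj ν.M₁ Z k : DetSet (F.P Kt)) k).symm i).1 : ℕ) * ‖(v) i‖ ^ 2)) ∧
        ∀ X : GaugeSlice (pts k Λ) T E3,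
          Real.sqrt (∑ i, ((((F.P Kt).L : ℝ) ^ (F.P Kt).d) / (((F.P Kt).L : ℝ) ^ 2)) ^ (((Node00.constrEnum (Bj ν.M₁ Z k : DetSet (F.P Kt)) k).symm i).1 : ℕ) * ‖(fderiv ℝ (msChart F 2 Kt k (Bj ν.M₁ Z k) (avgFamily (Node00.avOfRecord F 2 Kt) (qsstarGIter0 k (ext Vk))) U₀) 0 (fderiv ℝ Xf 0 X) - Lf (fderiv ℝ Xf 0 X)) i‖ ^ 2)
            ≤ (C₂ * max δc δin) * p (fderiv ℝ Xf 0 X) ∧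
          lam (Ψ₂ (fderiv ℝ Xf 0 X) (fderiv ℝ Xf 0 X)) ≤ (Cμ * max δc δin) * p (fderiv ℝ Xf 0 X) ^ 2 ∧
          p (fderiv ℝ Xf 0 X) ≤ (12 * 𝓐₀ / R * Real.sqrt (Nat.card {b : PBond (F.P Kt) 0 // b.src ∈ maxDomT ν.M₁ Z 1})) * ‖X‖ ∧
          ∃ m : ℝ, (∀ w', Lf w' = fderiv ℝ (msChart F 2 Kt k (Bj ν.M₁ Z k) (avgFamily (Node00.avOfRecord F 2 Kt) (qsstarGIter0 k (ext Vk))) U₀) 0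
                (fderiv ℝ Xf 0 X) →
              m ≤ fderiv ℝ (fun Y => fderiv ℝ (fun Y : PBond (F.P Kt) 0 → lieSU (Fin 2) => wilsonAction4 (expChart (1 : GaugeField (F.P Kt) 0 SU2) Y)) Y) 0 w' w') ∧
            (((F.P Kt).L : ℝ) ^ (F.P Kt).d) ^ k / ((((F.P Kt).L : ℝ)) ^ 2 * ((F.P Kt).L : ℝ) ^ 2) ^ k *
                (∑ z ∈ box (fun κ => (hi κ - lo κ + 1).toNat + 3) (fun κ => lo κ - 2), ∑ μ : Fin (F.P Kt).d, ∑ a : Fin 3,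
                  curl (fun b => ιA (pts k Λ) T X (⟨castSite b.1, b.2⟩ : PBond (F.P Kt) k) a) z ⟨0, h0⟩ μ ^ 2)
              - ((((F.P Kt).L : ℝ) ^ (F.P Kt).d) ^ k / ((((F.P Kt).L : ℝ)) ^ 2 * ((F.P Kt).L : ℝ) ^ 2) ^ k
                  * (16 * (((F.P Kt).d : ℝ) + 1) * (Cτ * max δc δin))) * ‖X‖ ^ 2 ≤ m := by
  obtain ⟨ρs, Cμ, Cρ, C₂, Cτ, hρs, hCμ, hCρ, hC₂, hCτ, H⟩ := chartLetter_of_letters_supNorm_N ν Kt h0 hk0 hk Z Λ T lo hi hM2 hdiv hbox hΩw N hN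
  -- the total row weight of print's η-units on `𝐁_k(Z)` (dag-n10-w1's `levelWeight`)
  let Sw : ℝ := Real.sqrt (∑ i : Fin (constrCard (Bj ν.M₁ Z k) k), levelWeight (F.P Kt) (((constrEnum (Bj ν.M₁ Z k) k).symm i).1 : ℕ))
  have hSw : 0 ≤ Sw := Real.sqrt_nonneg _
  refine ⟨ρs, Cμ, Cρ, C₂ * Sw, Cτ, hρs, hCμ, hCρ, mul_nonneg hC₂ hSw, hCτ, ?_⟩
  intro ext Vk R 𝓐₀ hR h𝓐₀ δc δin hδc0 hδin0 hδpos hδρ U₀ Xf hmin0 hC1 hCin hX₀ hXc hmin hKb hsupp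
  obtain ⟨Ψ₂, lam, p, Lf, Rf, hΨ₂, hΨd, hlam, hp, hRf, hρ, htail⟩ :=
    H ext Vk hR h𝓐₀ hδc0 hδin0 hδpos hδρ U₀ Xf hmin0 hC1 hCin hX₀ hXc hmin hKb hsupp
  refine ⟨Ψ₂, lam, p, Lf, Rf, hΨ₂, hΨd, hlam, hp, hRf, fun v => ?_, fun X => ?_⟩
  · -- `p (R_f v) ≤ ρc·‖v‖ ≤ ρc·q_η(v)` (every level weight is `≥ 1` at `d ≥ 2`)
    have h1 : ‖v‖ ≤ qEta (Bj ν.M₁ Z k : DetSet (F.P Kt)) k v := norm_le_qEta h2 (Bj ν.M₁ Z k) k v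
    calc p (Rf v) ≤ Cρ * ‖v‖ := hρ v
      _ ≤ Cρ * qEta (Bj ν.M₁ Z k : DetSet (F.P Kt)) k v := mul_le_mul_of_nonneg_left h1 hCρ
      _ = _ := by rw [qEta_def]
  · obtain ⟨hδ₂, hμ, hK, hm⟩ := htail X
    refine ⟨?_, hμ, hK, hm⟩
    -- `q_η(defect) ≤ √(Σ_i levelWeight j_i)·‖defect‖` (dag-n10-w1's (iii) §1, by name) `≤ √(Σ…)·(C₂·max δc δin)·p`
    have h1 := qEta_le_sqrt_sum_mul_norm (Bj ν.M₁ Z k : DetSet (F.P Kt)) k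
      (fderiv ℝ (msChart F 2 Kt k (Bj ν.M₁ Z k) (avgFamily (Node00.avOfRecord F 2 Kt) (qsstarGIter0 k (ext Vk))) U₀) 0 (fderiv ℝ Xf 0 X) - Lf (fderiv ℝ Xf 0 X))
    rw [qEta_def] at h1
    refine h1.trans ?_
    calc Sw * ‖fderiv ℝ (msChart F 2 Kt k (Bj ν.M₁ Z k) (avgFamily (Node00.avOfRecord F 2 Kt) (qsstarGIter0 k (ext Vk))) U₀) 0 (fderiv ℝ Xf 0 X) - Lf (fderiv ℝ Xf 0 X)‖
        ≤ Sw * ((C₂ * max δc δin) * p (fderiv ℝ Xf 0 X)) := mul_le_mul_of_nonneg_left hδ₂ hSw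
      _ = (C₂ * Sw * max δc δin) * p (fderiv ℝ Xf 0 X) := by ring

end Main

end Summit.QuantumFields.YangMills.BalabanUVNodes.N12NearFlatChartLetterN

end
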